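import Literature.Probability.RandomPlanarGeometry.ChordalRestrictionMarkov
import HarnessLib

/-!
# The restriction-kernel clause is inherited by smaller pinned sub-domains

Crux `AxiomsOfLimit` (stmt-CriticalPhenomena-1370), line `registered`, stub
`stub_kernelClauseInheritDown` (lead c5, wave 1). Theorems only.

The *kernel clause* for a measure `ν` on `CurveClass ℂ` at a Dobrushin domain `D'` reads
`P D' T · ν {γ ⊆ D̄'} = ν (T ∩ {γ ⊆ D̄'})` for every measurable `T`, where
`{γ ⊆ D̄'} = CurveClass.rangeSubset (closure D'.carrier)`. This file proves the *downward
inheritance*: if `P` has the two-sided restriction property and the clause holds for `ν` at a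
Dobrushin domain `D₁`, then it holds for `ν` at every Dobrushin `D' ⊆ D₁` with the same marked
points. The proof is pure algebra in `ℝ≥0∞` (no division): with `B' = {γ ⊆ D̄'} ⊆ B₁ = {γ ⊆ D̄₁}`,
`ν (T ∩ B') = P D₁ (T ∩ B') · ν B₁ = P D' T · P D₁ B' · ν B₁ = P D' T · ν B'`, using the clause
at `D₁` twice (on `T ∩ B'` and on `B'`) and restriction (i) for the pair `D' ⊆ D₁` once.

References: G. F. Lawler, O. Schramm, W. Werner, *Conformal restriction: the chordal case* (2003)
§1, §3; W. Werner, *Conformal restriction and related questions* (2003) §2. All [folklore].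
-/

noncomputable section

open MeasureTheory Set
open scoped ENNReal

namespace Summit.CriticalPhenomena.SAWScalingLimit.Theorems.AxiomsOfLimitKernelClause

open Literature.Probability.RandomPlanarGeometry

/-- **Downward inheritance of the restriction-kernel clause.** Let `P` be a chordal family with
the two-sided restriction property, `ν` a measure on curves, and `D' ⊆ D₁` Dobrushin domains with
the same marked points. If `P D₁ T · ν {γ ⊆ D̄₁} = ν (T ∩ {γ ⊆ D̄₁})` for every measurable `T`,
then `P D' T · ν {γ ⊆ D̄'} = ν (T ∩ {γ ⊆ D̄'})` for every measurable `T`: since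
`{γ ⊆ D̄'} ⊆ {γ ⊆ D̄₁}`, the clause at `D₁` (applied to `T ∩ {γ ⊆ D̄'}` and to `{γ ⊆ D̄'}`) and the
restriction identity `P D' T · P D₁ {γ ⊆ D̄'} = P D₁ (T ∩ {γ ⊆ D̄'})` combine by associativity.
[folklore] -/
theorem stub_kernelClauseInheritDown : ∀ (P : Literature.Probability.RandomPlanarGeometry.ChordalFamily), P.IsRestriction → ∀ (ν : MeasureTheory.Measure (Literature.Probability.RandomPlanarGeometry.CurveClass ℂ)) (D₁ D' : Literature.Probability.RandomPlanarGeometry.DobrushinDomain), D'.carrier ⊆ D₁.carrier → D'.pt 0 = D₁.pt 0 → D'.pt 1 = D₁.pt 1 → (∀ T : Set (Literature.Probability.RandomPlanarGeometry.CurveClass ℂ), MeasurableSet T → P D₁ T * ν (Literature.Probability.RandomPlanarGeometry.CurveClass.rangeSubset (closure D₁.carrier)) = ν (T ∩ Literature.Probability.RandomPlanarGeometry.CurveClass.rangeSubset (closure D₁.carrier))) → ∀ T : Set (Literature.Probability.RandomPlanarGeometry.CurveClass ℂ), MeasurableSet T → P D' T * ν (Literature.Probability.RandomPlanarGeometry.CurveClass.rangeSubset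 (closure D'.carrier)) = ν (T ∩ Literature.Probability.RandomPlanarGeometry.CurveClass.rangeSubset (closure D'.carrier)) := by
  intro P hR ν D₁ D' hsub h0 h1 hcl T hT
  -- `B' = {γ ⊆ D̄'} ⊆ B₁ = {γ ⊆ D̄₁}`, and `B'` is measurable (a closed event).
  have hBB : CurveClass.rangeSubset (closure D'.carrier) ⊆
      CurveClass.rangeSubset (closure D₁.carrier) :=
    fun c hc => CurveClass.mem_rangeSubset.2
      ((CurveClass.mem_rangeSubset.1 hc).trans (closure_mono hsub))
  have hB : MeasurableSet (CurveClass.rangeSubset (closure D'.carrier)) :=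
    CurveClass.measurableSet_rangeSubset isClosed_closure
  -- The clause at `D₁` on `T ∩ B'`: `P D₁ (T ∩ B') · ν B₁ = ν (T ∩ B')`.
  have h2 := hcl _ (hT.inter hB)
  rw [inter_assoc, inter_eq_self_of_subset_left hBB] at h2
  -- The clause at `D₁` on `B'`: `P D₁ B' · ν B₁ = ν B'`.
  have h3 := hcl _ hB
  rw [inter_eq_self_of_subset_left hBB] at h3
  -- Restriction (i) for `D' ⊆ D₁`: `P D' T · P D₁ B' = P D₁ (T ∩ B')`; conclude by associativity.
  rw [← h2, ← hR D₁ D' hsub h0 h1 T hT, ← h3, mul_assoc]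

end Summit.CriticalPhenomena.SAWScalingLimit.Theorems.AxiomsOfLimitKernelClause

end
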